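import Summits.CriticalPhenomena.SAWScalingLimit.Theses.SAWRenewalTightness
import Summits.CriticalPhenomena.SAWScalingLimit.Theorems.ShellCrossingBound.Negative.OfEventualTight
import Summits.CriticalPhenomena.SAWScalingLimit.Theorems.ShellCrossingBound.Negative.Forcing6Shell

/-!
# `EventualTight` — negative knowledge: boundary regularity is load-bearing (the dyadic snake)

Part 1: the dyadic snake domain `Snake.Ω` — geometry of the scales, openness, boundedness, CONNECTEDNESS (chain of convex boxes), the closed superset `S` pinning the ordinate on the walls (`im_mem_cwin_of_re_eq_m`), and the marked frontier points `0` and `5/8`.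

Support files for the crux `stmt-CriticalPhenomena-1372`
(`Summit.CriticalPhenomena.SAWScalingLimit.Theses.SAWRenewalTightness.EventualTight`; refuter `cdisprove`,
standing adversary; indexed work file
`Summits/CriticalPhenomena/SAWScalingLimit/Cruxes/EventualTight/Disproof.lean`, §5). The four parts
`Snake1Domain … Snake4Forcing` prove: over bounded open CONNECTED sets with two distinct marked FRONTIER
points (all the fields of `DobrushinDomain` except the Jordan boundary loop), the statement of the crux
is FALSE — so any proof of `EventualTight` must use the boundary loop (local connectivity of `∂Ω` at the
marked points). Everything proved, standard axioms. [folklore]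
-/

noncomputable section

open MeasureTheory Filter Topology Set Metric Complex
open Literature.Probability.RandomPlanarGeometry Literature.Probability.RandomPlanarGeometry.SAW
  Literature.Probability.LatticeModels
open scoped ENNReal NNReal unitInterval

namespace Summit.CriticalPhenomena.SAWScalingLimit.Theorems.EventualTight.Negative

open Summit.CriticalPhenomena.SAWScalingLimit.Theorems.ShellCrossingBound.Negative
  (exists_forall_not_hasTraversals_of_isCompact)
open Summit.CriticalPhenomena.SAWScalingLimit.Theorems.ShellCrossingBound.Negative.Forcing
  (meshPoint_vec vec_add_single_zero vec_add_single_one eq_vec exists_chain chain_lt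
    range_toCurve_subset toCurve_apply_one isProbabilityMeasure_law abs_im_sub_le_dist)

namespace Snake

/-! ### The dyadic snake: geometry -/

/-- Dyadic scales `r k = 2^{-k}`. [folklore] -/
def r (k : ℕ) : ℝ := (1 / 2 : ℝ) ^ k

/-- Left edge of the `k`-th column, `l k = (5/8) 2^{-k}`. [folklore] -/
def l (k : ℕ) : ℝ := 5 / 8 * r k

/-- Wall midpoints `m k = (9/16) 2^{-k}` (strictly between `r (k+1) = r k / 2` and `l k`). [folklore] -/
def m (k : ℕ) : ℝ := 9 / 16 * r k

/-- The window of the `k`-th connector: at the bottom for even `k`, at the top for odd `k`. [folklore] -/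
def win (k : ℕ) : Set ℝ := if Even k then Ioo 0 (1 / 4) else Ioo (3 / 4) 1

/-- Closed windows. [folklore] -/
def cwin (k : ℕ) : Set ℝ := if Even k then Icc 0 (1 / 4) else Icc (3 / 4) 1

/-- The `k`-th column `(l k, r k) × (0, 1)`. [folklore] -/
def col (k : ℕ) : Set ℂ := Ioo (l k) (r k) ×ℂ Ioo 0 1

/-- The `k`-th connector `(l (k+1), r k) × win k`, bridging the wall between columns `k+1` and `k`. [folklore] -/
def conn (k : ℕ) : Set ℂ := Ioo (l (k + 1)) (r k) ×ℂ win k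

/-- **The snake domain**: columns of width `(3/8) 2^{-k}` accumulating at the imaginary axis, joined
alternately at the bottom and at the top. Open, bounded, connected; its frontier contains the
segment `{0} × [0, 1]` and is NOT locally connected there (not a Jordan domain). [folklore] -/
def Ω : Set ℂ := ⋃ k : ℕ, (col k ∪ conn k)

/-- Snake bookkeeping (`r_pos`). [folklore] -/
theorem r_pos (k : ℕ) : 0 < r k := by unfold r; positivity

/-- Snake bookkeeping (`r_zero`). [folklore] -/
theorem r_zero : r 0 = 1 := by simp [r]

/-- Snake bookkeeping (`r_succ`). [folklore] -/
theorem r_succ (k : ℕ) : r (k + 1) = r k / 2 := by unfold r; rw [pow_succ]; ring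

/-- Snake bookkeeping (`r_le_one`). [folklore] -/
theorem r_le_one (k : ℕ) : r k ≤ 1 := pow_le_one₀ (by norm_num) (by norm_num)

/-- Snake bookkeeping (`r_antitone`). [folklore] -/
theorem r_antitone : Antitone r := fun _ _ h => pow_le_pow_of_le_one (by norm_num) (by norm_num) h

/-- Snake bookkeeping (`r_lt_of_lt`). [folklore] -/
theorem r_lt_of_lt {j k : ℕ} (h : j < k) : r k < r j :=
  pow_lt_pow_right_of_lt_one₀ (by norm_num) (by norm_num) h

/-- Snake bookkeeping (`l_pos`). [folklore] -/
theorem l_pos (k : ℕ) : 0 < l k := by unfold l; have := r_pos k; positivity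

/-- Snake bookkeeping (`l_lt_r`). [folklore] -/
theorem l_lt_r (k : ℕ) : l k < r k := by unfold l; have := r_pos k; linarith

/-- Snake bookkeeping (`l_antitone`). [folklore] -/
theorem l_antitone : Antitone l := fun _ _ h => by
  unfold l; exact mul_le_mul_of_nonneg_left (r_antitone h) (by norm_num)

/-- Snake bookkeeping (`l_succ_lt_r_succ`). [folklore] -/
theorem l_succ_lt_r_succ (k : ℕ) : l (k + 1) < r (k + 1) := l_lt_r _

/-- Snake bookkeeping (`r_succ_lt_m`). [folklore] -/
theorem r_succ_lt_m (k : ℕ) : r (k + 1) < m k := by rw [r_succ]; unfold m; have := r_pos k; linarith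

/-- Snake bookkeeping (`m_lt_l`). [folklore] -/
theorem m_lt_l (k : ℕ) : m k < l k := by unfold m l; have := r_pos k; linarith

/-- Snake bookkeeping (`m_antitone_strict`). [folklore] -/
theorem m_antitone_strict {j k : ℕ} (h : j < k) : m k < m j := by
  unfold m; have := r_lt_of_lt h; linarith

/-- Snake bookkeeping (`m_le_one`). [folklore] -/
theorem m_le_one (k : ℕ) : m k ≤ 1 := by unfold m; have := r_le_one k; have := r_pos k; linarith

/-- Snake bookkeeping (`m_nonneg`). [folklore] -/
theorem m_nonneg (k : ℕ) : 0 ≤ m k := by unfold m; have := r_pos k; positivity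

/-- Snake bookkeeping (`win_subset`). [folklore] -/
theorem win_subset (k : ℕ) : win k ⊆ Ioo 0 1 := by
  unfold win; split_ifs
  · exact Ioo_subset_Ioo le_rfl (by norm_num)
  · exact Ioo_subset_Ioo (by norm_num) le_rfl

/-- Snake bookkeeping (`win_subset_cwin`). [folklore] -/
theorem win_subset_cwin (k : ℕ) : win k ⊆ cwin k := by
  unfold win cwin; split_ifs <;> exact Ioo_subset_Icc_self

/-- Snake bookkeeping (`isClosed_cwin`). [folklore] -/
theorem isClosed_cwin (k : ℕ) : IsClosed (cwin k) := by
  unfold cwin; split_ifs <;> exact isClosed_Icc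

/-- Snake bookkeeping (`isOpen_win`). [folklore] -/
theorem isOpen_win (k : ℕ) : IsOpen (win k) := by
  unfold win; split_ifs <;> exact isOpen_Ioo

/-- Snake bookkeeping (`convex_win`). [folklore] -/
theorem convex_win (k : ℕ) : Convex ℝ (win k) := by
  unfold win; split_ifs <;> exact convex_Ioo _ _

/-- Snake bookkeeping (`col_subset_Ω`). [folklore] -/
theorem col_subset_Ω (k : ℕ) : col k ⊆ Ω := fun _ hz => mem_iUnion.2 ⟨k, Or.inl hz⟩

/-- Snake bookkeeping (`conn_subset_Ω`). [folklore] -/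
theorem conn_subset_Ω (k : ℕ) : conn k ⊆ Ω := fun _ hz => mem_iUnion.2 ⟨k, Or.inr hz⟩

/-- A box with convex sides is convex. [folklore] -/
theorem convex_reProdIm {s t : Set ℝ} (hs : Convex ℝ s) (ht : Convex ℝ t) : Convex ℝ (s ×ℂ t) := by
  have := convex_convexHull ℝ (s ×ℂ t)
  rwa [Complex.convexHull_reProdIm, hs.convexHull_eq, ht.convexHull_eq] at this

/-- Snake bookkeeping (`convex_col`). [folklore] -/
theorem convex_col (k : ℕ) : Convex ℝ (col k) := convex_reProdIm (convex_Ioo _ _) (convex_Ioo _ _)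

/-- Snake bookkeeping (`convex_conn`). [folklore] -/
theorem convex_conn (k : ℕ) : Convex ℝ (conn k) := convex_reProdIm (convex_Ioo _ _) (convex_win k)

/-- Snake bookkeeping (`isOpen_Ω`). [folklore] -/
theorem isOpen_Ω : IsOpen Ω :=
  isOpen_iUnion fun k => (isOpen_Ioo.reProdIm isOpen_Ioo).union (isOpen_Ioo.reProdIm (isOpen_win k))

/-- Every point of the snake has `0 < re ≤ 1` and `0 < im < 1`. [folklore] -/
theorem re_im_of_mem {z : ℂ} (hz : z ∈ Ω) : 0 < z.re ∧ z.re < 1 ∧ 0 < z.im ∧ z.im < 1 := by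
  obtain ⟨k, hk⟩ := mem_iUnion.1 hz
  rcases hk with ⟨hre, him⟩ | ⟨hre, him⟩
  · exact ⟨(l_pos k).trans hre.1, hre.2.trans_le (r_le_one k), him.1, him.2⟩
  · have him' := win_subset k him
    exact ⟨(l_pos _).trans hre.1, hre.2.trans_le (r_le_one k), him'.1, him'.2⟩

/-- Snake bookkeeping (`isBounded_Ω`). [folklore] -/
theorem isBounded_Ω : Bornology.IsBounded Ω := by
  refine (isBounded_iff_subset_closedBall 0).2 ⟨2, fun z hz => ?_⟩
  obtain ⟨h1, h2, h3, h4⟩ := re_im_of_mem hz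
  rw [mem_closedBall, dist_zero_right]
  refine (norm_le_abs_re_add_abs_im z).trans ?_
  rw [abs_of_pos h1, abs_of_pos h3]
  linarith

/-- A point in `col k ∩ conn k`. [folklore] -/
def pcc (k : ℕ) : ℂ := ⟨3 / 4 * r k, if Even k then 1 / 8 else 7 / 8⟩

/-- Snake bookkeeping (`pcc_mem_col`). [folklore] -/
theorem pcc_mem_col (k : ℕ) : pcc k ∈ col k := by
  have := r_pos k; have := r_le_one k
  refine ⟨⟨?_, ?_⟩, ?_⟩
  · show l k < 3 / 4 * r k; unfold l; linarith
  · show 3 / 4 * r k < r k; linarith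
  · show (if Even k then (1:ℝ) / 8 else 7 / 8) ∈ Ioo 0 1
    split_ifs <;> constructor <;> norm_num

/-- Snake bookkeeping (`pcc_mem_conn`). [folklore] -/
theorem pcc_mem_conn (k : ℕ) : pcc k ∈ conn k := by
  have := r_pos k
  refine ⟨⟨?_, ?_⟩, ?_⟩
  · show l (k + 1) < 3 / 4 * r k; unfold l; rw [r_succ]; linarith
  · show 3 / 4 * r k < r k; linarith
  · show (if Even k then (1:ℝ) / 8 else 7 / 8) ∈ win k
    unfold win; split_ifs <;> constructor <;> norm_num

/-- A point in `conn k ∩ col (k+1)`. [folklore] -/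
def pcn (k : ℕ) : ℂ := ⟨3 / 4 * r (k + 1), if Even k then 1 / 8 else 7 / 8⟩

/-- Snake bookkeeping (`pcn_mem_conn`). [folklore] -/
theorem pcn_mem_conn (k : ℕ) : pcn k ∈ conn k := by
  have := r_pos k
  refine ⟨⟨?_, ?_⟩, ?_⟩
  · show l (k + 1) < 3 / 4 * r (k + 1); unfold l; linarith [r_pos (k + 1)]
  · show 3 / 4 * r (k + 1) < r k; rw [r_succ]; linarith
  · show (if Even k then (1:ℝ) / 8 else 7 / 8) ∈ win k
    unfold win; split_ifs <;> constructor <;> norm_num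

/-- Snake bookkeeping (`pcn_mem_col_succ`). [folklore] -/
theorem pcn_mem_col_succ (k : ℕ) : pcn k ∈ col (k + 1) := by
  have := r_pos (k + 1); have := r_le_one (k + 1)
  refine ⟨⟨?_, ?_⟩, ?_⟩
  · show l (k + 1) < 3 / 4 * r (k + 1); unfold l; linarith
  · show 3 / 4 * r (k + 1) < r (k + 1); linarith
  · show (if Even k then (1:ℝ) / 8 else 7 / 8) ∈ Ioo 0 1
    split_ifs <;> constructor <;> norm_num

/-- Snake bookkeeping (`isConnected_Ω`). [folklore] -/
theorem isConnected_Ω : IsConnected Ω := by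
  refine IsConnected.iUnion_of_chain (fun k => ?_) (fun k => ?_)
  · exact IsConnected.union ⟨pcc k, pcc_mem_col k, pcc_mem_conn k⟩
      ((convex_col k).isConnected ⟨pcc k, pcc_mem_col k⟩)
      ((convex_conn k).isConnected ⟨pcc k, pcc_mem_conn k⟩)
  · refine ⟨pcn k, Or.inr (pcn_mem_conn k), ?_⟩
    rw [Nat.succ_eq_succ]
    exact Or.inl (pcn_mem_col_succ k)

/-- A closed superset of the snake pinning the ordinate on the wall strips. [folklore] -/
def S : Set ℂ :=
  ({z : ℂ | 0 ≤ z.re} ∩ {z | z.re ≤ 1} ∩ {z | 0 ≤ z.im} ∩ {z | z.im ≤ 1}) ∩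
    ⋂ k : ℕ, ({z : ℂ | z.re ≤ r (k + 1)} ∪ {z | l k ≤ z.re} ∪ {z | z.im ∈ cwin k})

/-- Snake bookkeeping (`isClosed_S`). [folklore] -/
theorem isClosed_S : IsClosed S := by
  refine IsClosed.inter ?_ (isClosed_iInter fun k => ?_)
  · exact (((isClosed_le continuous_const continuous_re).inter
      (isClosed_le continuous_re continuous_const)).inter
      (isClosed_le continuous_const continuous_im)).inter
      (isClosed_le continuous_im continuous_const)
  · exact ((isClosed_le continuous_re continuous_const).union
      (isClosed_le continuous_const continuous_re)).union
      ((isClosed_cwin k).preimage continuous_im)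

/-- Snake bookkeeping (`Ω_subset_S`). [folklore] -/
theorem Ω_subset_S : Ω ⊆ S := by
  intro z hz
  obtain ⟨h1, h2, h3, h4⟩ := re_im_of_mem hz
  refine ⟨⟨⟨⟨h1.le, h2.le⟩, h3.le⟩, h4.le⟩, mem_iInter.2 fun k => ?_⟩
  obtain ⟨j, hj⟩ := mem_iUnion.1 hz
  rcases hj with ⟨hre, -⟩ | ⟨hre, him⟩
  · -- `z ∈ col j`
    rcases le_or_gt (k + 1) j with hkj | hkj
    · exact Or.inl (Or.inl (hre.2.le.trans (r_antitone hkj)))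
    · exact Or.inl (Or.inr ((l_antitone (Nat.lt_succ_iff.1 hkj)).trans hre.1.le))
  · -- `z ∈ conn j`
    rcases lt_trichotomy j k with hjk | rfl | hjk
    · exact Or.inl (Or.inr ((l_antitone (Nat.succ_le_of_lt hjk)).trans hre.1.le))
    · exact Or.inr (win_subset_cwin j him)
    · exact Or.inl (Or.inl (hre.2.le.trans (r_antitone (Nat.succ_le_of_lt hjk))))

/-- Snake bookkeeping (`closure_Ω_subset_S`). [folklore] -/
theorem closure_Ω_subset_S : closure Ω ⊆ S := closure_minimal Ω_subset_S isClosed_S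

/-- **On the `k`-th wall the ordinate of `closure Ω` is pinned to the closed window.** [folklore] -/
theorem im_mem_cwin_of_re_eq_m {z : ℂ} (hz : z ∈ closure Ω) {k : ℕ} (hre : z.re = m k) :
    z.im ∈ cwin k := by
  have h := (mem_iInter.1 (closure_Ω_subset_S hz).2 k)
  rcases h with (h | h) | h
  · exact absurd (hre ▸ h : m k ≤ r (k + 1)) (not_le.2 (r_succ_lt_m k))
  · exact absurd (hre ▸ h : l k ≤ m k) (not_le.2 (m_lt_l k))
  · exact h

/-- Snake bookkeeping (`re_im_of_mem_closure`). [folklore] -/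
theorem re_im_of_mem_closure {z : ℂ} (hz : z ∈ closure Ω) :
    0 ≤ z.re ∧ z.re ≤ 1 ∧ 0 ≤ z.im ∧ z.im ≤ 1 := by
  obtain ⟨⟨⟨⟨h1, h2⟩, h3⟩, h4⟩, -⟩ := closure_Ω_subset_S hz
  exact ⟨h1, h2, h3, h4⟩

/-! ### The marked frontier points `p = 0` (at the accumulation) and `q = 5/8` -/

/-- Snake bookkeeping (`zero_not_mem`). [folklore] -/
theorem zero_not_mem : (0 : ℂ) ∉ Ω := fun h => by simpa using (re_im_of_mem h).1

/-- Snake bookkeeping (`zero_mem_closure`). [folklore] -/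
theorem zero_mem_closure : (0 : ℂ) ∈ closure Ω := by
  rw [Metric.mem_closure_iff]
  intro ε hε
  obtain ⟨k, hk⟩ := exists_pow_lt_of_lt_one hε (by norm_num : (1 / 2 : ℝ) < 1)
  refine ⟨⟨3 / 4 * r k, 1 / 8 * r k⟩, col_subset_Ω k ⟨⟨?_, ?_⟩, ?_, ?_⟩, ?_⟩
  · show l k < 3 / 4 * r k; unfold l; linarith [r_pos k]
  · show 3 / 4 * r k < r k; linarith [r_pos k]
  · show 0 < 1 / 8 * r k; linarith [r_pos k]
  · show 1 / 8 * r k < 1; linarith [r_le_one k]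
  · rw [dist_comm, dist_zero_right]
    refine (norm_le_abs_re_add_abs_im _).trans_lt ?_
    have hr := r_pos k
    simp only [abs_of_pos (by positivity : (0:ℝ) < 3 / 4 * r k),
      abs_of_pos (by positivity : (0:ℝ) < 1 / 8 * r k)]
    have : r k < ε := hk
    linarith

/-- Snake bookkeeping (`zero_mem_frontier`). [folklore] -/
theorem zero_mem_frontier : (0 : ℂ) ∈ frontier Ω := by
  rw [frontier, isOpen_Ω.interior_eq]
  exact ⟨zero_mem_closure, zero_not_mem⟩

/-- Snake bookkeeping (`q_not_mem`). [folklore] -/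
theorem q_not_mem : ((5 / 8 : ℝ) : ℂ) ∉ Ω := fun h => by simpa using (re_im_of_mem h).2.2.1

/-- Snake bookkeeping (`q_mem_closure`). [folklore] -/
theorem q_mem_closure : ((5 / 8 : ℝ) : ℂ) ∈ closure Ω := by
  rw [Metric.mem_closure_iff]
  intro ε hε
  set t : ℝ := min (ε / 4) (1 / 4) with ht
  have ht0 : 0 < t := lt_min (by positivity) (by norm_num)
  have htε : t ≤ ε / 4 := min_le_left _ _
  have ht4 : t ≤ 1 / 4 := min_le_right _ _
  refine ⟨⟨5 / 8 + t, t⟩, col_subset_Ω 0 ⟨⟨?_, ?_⟩, ?_, ?_⟩, ?_⟩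
  · show l 0 < 5 / 8 + t; unfold l; rw [r_zero]; linarith
  · show 5 / 8 + t < r 0; rw [r_zero]; linarith
  · exact ht0
  · show t < 1; linarith
  · rw [Complex.dist_eq]
    refine (norm_le_abs_re_add_abs_im _).trans_lt ?_
    simp only [sub_re, sub_im, ofReal_re, ofReal_im]
    rw [show (5 : ℝ) / 8 - (5 / 8 + t) = -t by ring, show (0 : ℝ) - t = -t by ring, abs_neg,
      abs_of_pos ht0]
    linarith

/-- Snake bookkeeping (`q_mem_frontier`). [folklore] -/
theorem q_mem_frontier : ((5 / 8 : ℝ) : ℂ) ∈ frontier Ω := by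
  rw [frontier, isOpen_Ω.interior_eq]
  exact ⟨q_mem_closure, q_not_mem⟩

end Snake

end Summit.CriticalPhenomena.SAWScalingLimit.Theorems.EventualTight.Negative

end
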